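import Literature.NumberTheory.Automorphic.ShimuraCurveRibetTakahashi
import HarnessLib

/-!
# Integral forms on Shimura curves are not too small: Pasten's Theorem 14.1 in the instance
# `f_{D,M} = Ψ(φ_{D,M}^• ω_A)` consumed by the proof of Theorems 16.1 / 16.4

Topic `Literature/NumberTheory/Automorphic` (family `abc`; candidate column A1′ of LADDER-ABC, the
valuation-product bounds; cross-ladder literature-typing seat lit-abc-pasten g6). ONE named fact
(`def … : Prop`, CONVENTIONS §4, typed ≠ proved), over the vocabulary of `ShimuraCurve.lean` /
`ShimuraCurveRibetTakahashi.lean`, from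

* H. Pasten, *Shimura curves and the abc conjecture*, J. Number Theory **254** (2024) 214–335 =
  arXiv:1705.09251v4 [`PastenShimura2024`] (held TeX, READ: §4.6 p. 15, §5.3 with Prop. 5.1,
  Lemma 5.2 and Cor. 5.3 p. 17, §14.1 with Thm. 14.1 p. 44, §16.1 proof of Thm. 16.1 p. 49,
  §16.2 proof of Thm. 16.4 p. 50).

  > **Theorem 14.1 (Integral forms are not too small).** Given `ε > 0`, if `N ≫_ε 1` and if `N = DM`
  > is an admissible factorization with `D > 1`, then for every `f ∈ 𝒮₂^D(M)` integral non-zero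
  > modular form for `U₀^D(M)` we have `−log ‖f‖_{U₀^D(M),2} ≤ (5/6 + ε) log N + ½ log M`.

  Here `‖·‖_{U,2}` is the NON-normalised Petersson norm `(∫_{Γ̃_U∖𝔥} |f|² Im(z)² dμ)^{1/2}` (§4.6
  p. 15, §8.1 p. 29) = the tree's `ShimuraCurveData.norm` (`X.normSq f = ∫_{X.fd} ‖f z‖² (Im z)² dμ`,
  the rendering of `PastenShimura2024_thm_8_1`), and
  `𝒮₂^D(M) = Ψ_{U₀^D(M)}(H⁰(𝒳₀^D(M)⁰, Ω¹_{𝒳₀^D(M)/ℤ})) ⊆ S₂^D(M)` (§14.1 p. 44) is the lattice of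
  forms coming from sections of the relative differentials on the smooth locus of the integral model
  `𝒳₀^D(M)` — a notion with NO carrier in Mathlib or the tree (`ShimuraCurveData` is the
  complex-analytic presentation `ι(O¹)∖𝔥` only; the review of 2026-08-15 recorded in
  `ShimuraCurveRibetTakahashi.lean`, "Not here", rejected an `∃ Sint`-closed rendering as vacuous).

  The theorem is therefore typed in the ONE INSTANCE the paper itself consumes (proof of Thm. 16.1,
  p. 49, re-used verbatim in the proof of Thm. 16.4, p. 50: "The rest of the proof continues in the
  same way"), where the integral form is explicit:

  > From Corollary 5.3, we recall that there is a non-constant morphism `φ_{D,M} : X₀^D(M) → A_{D,M}`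
  > [defined over `ℚ`, Cor. 5.3] satisfying `δ_{D,M} ≤ deg φ_{D,M} ≤ (9 log N)² δ_{D,M}`. Let
  > `𝒜_{D,M}` be the Néron model of `A_{D,M}` over `ℤ`, then by the Néron mapping property `φ_{D,M}`
  > extends to a `ℤ`-morphism of integral models on the smooth locus `φ_{D,M} : 𝒳₀^D(M)⁰ → 𝒜_{D,M}`.
  > Let `ω_{A_{D,M}}` be a Néron differential of `A_{D,M}` (unique up to sign) and let
  > `α_{D,M} = φ_{D,M}^• ω_{A_{D,M}} ∈ H⁰(𝒳₀^D(M)⁰, Ω¹)` … Then `f_{D,M} = Ψ_{U₀^D(M)}(α_{D,M}) ∈ 𝒮₂^D(M)`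
  > is integral … since `f_{D,M} ∈ 𝒮₂^D(M)` is integral and non-zero, by Theorem 14.1 we obtain
  > `−2 log ‖f_{D,M}‖_{U₀^D(M),2} ≤ (5/3 + ε/2) log N + log M` provided that `N ≫_ε 1`.

  (`A_{D,M}` = the optimal quotient of `J₀^D(M)` attached to `E` by Jacquet–Langlands, an elliptic
  curve isogenous to `E` over `ℚ`, §2 p. 12; `δ_{D,M}` its modular degree; `N = N_E`, the conductor;
  Cor. 5.3 p. 17 needs `N ≥ 11`, absorbed in `N ≫_ε 1`. Neither Cor. 5.3 nor Thm. 14.1 assumes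
  anything on `E` beyond "conductor `N = DM` admissible".)

## Rendering (the reviewer's checklist)

* `E` = a globally minimal elliptic `W : WeierstrassCurve ℚ` of conductor `N = W.conductorNorm ℤ`,
  `N = D M` admissible (`IsAdmissibleFactorization N D M`), `1 < D`, `X : ShimuraCurveData D M` any
  presentation of `X₀^D(M)` — exactly the binders of `nonempty_shimuraParametrizationData` and
  `PastenShimura2024_thm_6_1(_b)`.
* `A_{D,M}` with its Néron differential = a globally minimal model `W₀` (`IsGloballyMinimal`), so
  that the invariant differential `ω_{W₀}` is `±` the Néron differential and the datum lattice
  `Λ_{W₀}` is the Néron lattice (the idiom of `PastenShimura2024_cor_10_2` and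
  `exists_optimal_modularParametrizationData`); `W.IsIsogenous W₀` ("isogenous to `E` over `ℚ`").
* `φ_{D,M}` = a datum `P : ShimuraParametrizationData X W₀` (its form `P.form = Ψ(φ^• ω_{W₀}) = ± f_{D,M}`,
  periods in `Λ_{W₀}`, Hecke line of `W₀`, `P.deg = deg φ_{D,M}` as a fibre count — the structure's
  own reading of "`φ_{D,M,n} = q ∘ j_{D,M,n}` composed with an isogeny", `ShimuraCurve.lean`).
* `deg φ_{D,M} ≤ (9 log N)² δ_{D,M}` with `δ_{D,M}` = the least degree of a datum on `X` of a curve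
  `ℚ`-isogenous to `E` (the tree's `IsMinimalFor` idiom, module docstring of
  `ShimuraCurveRibetTakahashi.lean`): rendered `∀ P'` of the class, `P.deg ≤ (9 log N)² · P'.deg`
  (equivalent to the bound against the minimum; the printed `δ ∣ deg φ`, `δ ≤ deg φ` are dropped —
  WEAKER, trivially). Natural logarithm (Lemma 5.2: a prime `ℓ ≤ 2 + 2 log N`, `ℓ ∤ N`).
* The displayed bound `−2 log ‖f_{D,M}‖ ≤ (5/3 + ε/2) log N + log M` for the NON-ZERO form `f_{D,M}`
  is rendered EXPONENTIATED: `N^{−(5/3+ε)} · M⁻¹ ≤ ‖f_{D,M}‖² = X.normSq P.form` — equivalent for a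
  positive norm, and free of the junk value `Real.log 0 = 0` (a logarithmic rendering would hold
  vacuously for a datum with `X.normSq P.form = 0`); the logarithmic form and `0 < ‖f_{D,M}‖²` are
  RECOVERED below (`.neg_log_normSq_le`, `.normSq_pos`). The printed `ε/2` is written `ε` (the
  statement is `∀ ε > 0`, the same assertion).
* "`N ≫_ε 1`" = a threshold `N₀(ε)` (effectivity dropped, as in every sibling fact).

So the fact is the CONJUNCTION, for the one morphism `φ_{D,M}` of Cor. 5.3, of three printed
assertions: Cor. 5.3 (existence over `ℚ` and the degree sandwich), the integrality of `f_{D,M}`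
(p. 49, Néron mapping property) and Thm. 14.1 applied to it (the displayed inequality of p. 49).
It is WEAKER than Thm. 14.1 (one integral form instead of all of `𝒮₂^D(M) ∖ {0}`) and not stronger
than anything printed. It is NOT a restatement or a slice of `pastenShimura2024_thm_16_4` /
`_thm_16_1` (`PastenValuationProductsAdmissible.lean`): those bound `∏_{p∣D} v_p(Δ_E)`; this bounds
the Petersson norm of one quaternionic form and says nothing about discriminants or `δ_{1,N}` — it
is the Arakelov-theoretic INPUT (§§8–14: injectivity radius Thm. 1.7, the `L²–L^∞` comparison
Thm. 8.1 = tree fact `PastenShimura2024_thm_8_1`, heights of Heegner points after Yuan–Zhang and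
Kudla–Rapoport–Yang, Prop. 14.2) that the §16 engine consumes, listed as "(no declaration in the
tree)" in the docstrings of `jlPackage_printedClass_of_facts`
(`Summits/ABC/ABC/Theorems/RibetTakahashiSplitManyPrimeValuationProductJLPackagePrintedClass.lean`) and
of `PastenValuationProductsAdmissible.lean`. With it, Thm. 16.4 becomes a theorem over the engine
facts (companion `DiophantineGeometry/PastenThm164FromShimuraEngineProofs.lean`).

-- TODO(general form): Thm. 14.1 for every non-zero `f ∈ 𝒮₂^D(M)` needs the integral model
-- `𝒳₀^D(M)/ℤ` (§4.2 of the paper) and `Ψ_U` on `H⁰(𝒳⁰, Ω¹)`; not in the tree.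

## API (proved here)

* `PastenShimura2024_thm_14_1_fDM.normSq_pos`, `.neg_log_normSq_le` — `‖f_{D,M}‖² > 0` and the
  printed logarithmic display, recovered from the exponentiated rendering;
* `PastenShimura2024_thm_14_1_fDM.isMinimalFor` — the degree sandwich against a datum realising
  `δ_{D,M}` (`IsMinimalFor`), the shape in which `PastenShimura2024_thm_6_1(_b)` is consumed.

## What is NOT here

Thm. 14.1 in general (above); its proof (§§8–14); Cor. 5.3's divisibility `δ ∣ deg φ`; the
effective dependence of `N₀` on `ε`; the case `D = 1` (excluded in print: "for the results in this
section the case `D = 1` is already known by using methods based on `q`-expansions", §14.1 p. 44).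

## References

* [PastenShimura2024] H. Pasten, J. Number Theory 254 (2024) 214–335 = arXiv:1705.09251v4: §4.6
  p. 15 (non-normalised Petersson norm), Prop. 5.1 / Lemma 5.2 / Cor. 5.3 p. 17, Thm. 14.1 p. 44,
  proof of Thm. 16.1 p. 49 (the display `−2 log ‖f_{D,M}‖ ≤ (5/3 + ε/2) log N + log M`), proof of
  Thm. 16.4 p. 50.
-/

noncomputable section

open scoped MatrixGroups ModularForm

namespace Literature.NumberTheory.Automorphic

/-- NAMED FACT — **Pasten 2024, Theorem 14.1 ("Integral forms are not too small", arXiv:1705.09251v4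
§14.1 p. 44) in the instance `f_{D,M} = Ψ(φ_{D,M}^• ω_{A_{D,M}})` of the proof of Theorem 16.1
(§16.1 p. 49), together with Corollary 5.3 (p. 17) for `φ_{D,M}`.** Printed: Thm. 14.1 — "Given
`ε > 0`, if `N ≫_ε 1` and if `N = DM` is an admissible factorization with `D > 1`, then for every
`f ∈ 𝒮₂^D(M)` integral non-zero modular form for `U₀^D(M)` we have
`−log ‖f‖_{U₀^D(M),2} ≤ (5/6 + ε) log N + ½ log M`"; Cor. 5.3 — "there is a non-constant morphism
`φ : X₀^D(M) → A` defined over `ℚ` such that `δ` divides `deg φ` and moreover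
`δ ≤ deg φ ≤ (9 log N)² · δ`" (`A = A_{D,M}` the optimal quotient, isogenous to `E` over `ℚ`,
`δ = δ_{D,M}`, `N = N_E = DM ≥ 11`); p. 49 — "`f_{D,M} = Ψ_{U₀^D(M)}(φ_{D,M}^• ω_{A_{D,M}}) ∈ 𝒮₂^D(M)`
is integral [Néron mapping property] … by Theorem 14.1 we obtain
`−2 log ‖f_{D,M}‖_{U₀^D(M),2} ≤ (5/3 + ε/2) log N + log M` provided that `N ≫_ε 1`."
Rendering (module docstring): `E` = a globally minimal `W` of conductor `N`, `N = DM` admissible,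
`1 < D`, `X` any datum of level `(D, M)`; `A_{D,M}` with its Néron differential = a globally
minimal `W₀` with `W ∼ W₀`; `φ_{D,M}` = a datum `P` of `W₀` on `X` (`P.form = ±f_{D,M}`,
`P.deg = deg φ_{D,M}`); `deg φ ≤ (9 log N)² δ_{D,M}` as `P.deg ≤ (9 log N)² P'.deg` for every datum
`P'` on `X` of a curve of the class; `‖·‖² = X.normSq` (non-normalised, §4.6); the display for the
non-zero `f_{D,M}` exponentiated, `N^{−(5/3+ε)} M⁻¹ ≤ ‖f_{D,M}‖²` (junk-free; log form recovered in
`.neg_log_normSq_le`), `ε/2` written `ε`; `N ≫_ε 1` as a threshold `N₀(ε)`. WEAKER than print (one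
integral form; `δ ∣ deg φ` dropped); the general Thm. 14.1 needs the integral model `𝒳₀^D(M)`, not
in the tree. [cite: PastenShimura2024, Thm. 14.1 p. 44 with Cor. 5.3 p. 17 and the proof of Thm. 16.1 p. 49 (arXiv:1705.09251v4)] -/
def PastenShimura2024_thm_14_1_fDM : Prop :=
  ∀ ε : ℝ, 0 < ε → ∃ N₀ : ℕ, ∀ {N D M : ℕ}, IsAdmissibleFactorization N D M → 1 < D → N₀ ≤ N →
    ∀ (X : ShimuraCurveData D M) (W : WeierstrassCurve ℚ) [W.IsElliptic] [W.IsGloballyMinimal],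
      W.conductorNorm ℤ = N →
      ∃ (W₀ : WeierstrassCurve ℚ) (_ : W₀.IsElliptic) (_ : W₀.IsGloballyMinimal)
        (P : ShimuraParametrizationData X W₀),
        W.IsIsogenous W₀ ∧
        (∀ (W' : WeierstrassCurve ℚ) [W'.IsElliptic] (P' : ShimuraParametrizationData X W'),
            W.IsIsogenous W' → (P.deg : ℝ) ≤ (9 * Real.log N) ^ 2 * P'.deg) ∧
        (N : ℝ) ^ (-(5 / 3 + ε)) * (M : ℝ)⁻¹ ≤ X.normSq P.form

namespace PastenShimura2024_thm_14_1_fDM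

/-- **`‖f_{D,M}‖² > 0`** for the datum of the fact: the exponentiated bound has a positive left-hand
side (`N, M ≥ 1` in an admissible factorisation) — print's "integral and non-zero".
[cite: PastenShimura2024, proof of Thm. 16.1 p. 49 (f_{D,M} non-zero)] -/
theorem normSq_pos {N D M : ℕ} (hadm : IsAdmissibleFactorization N D M) {ε : ℝ}
    {X : ShimuraCurveData D M} {W₀ : WeierstrassCurve ℚ} {P : ShimuraParametrizationData X W₀}
    (h : (N : ℝ) ^ (-(5 / 3 + ε)) * (M : ℝ)⁻¹ ≤ X.normSq P.form) : 0 < X.normSq P.form := by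
  have hN : (0 : ℝ) < N := by
    have := Nat.mul_pos hadm.pos_left hadm.pos_right
    rw [hadm.mul_eq] at this
    exact_mod_cast this
  have hM : (0 : ℝ) < M := by exact_mod_cast hadm.pos_right
  exact lt_of_lt_of_le (by positivity) h

/-- **The printed logarithmic display**, `−2 log ‖f_{D,M}‖ = −log ‖f_{D,M}‖² ≤ (5/3 + ε) log N + log M`,
recovered from the exponentiated rendering (for a positive norm the two are equivalent).
[cite: PastenShimura2024, proof of Thm. 16.1 p. 49 (display after (EqRTF))] -/
theorem neg_log_normSq_le {N D M : ℕ} (hadm : IsAdmissibleFactorization N D M) {ε : ℝ}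
    {X : ShimuraCurveData D M} {W₀ : WeierstrassCurve ℚ} {P : ShimuraParametrizationData X W₀}
    (h : (N : ℝ) ^ (-(5 / 3 + ε)) * (M : ℝ)⁻¹ ≤ X.normSq P.form) :
    -Real.log (X.normSq P.form) ≤ (5 / 3 + ε) * Real.log N + Real.log M := by
  have hN : (0 : ℝ) < N := by
    have := Nat.mul_pos hadm.pos_left hadm.pos_right
    rw [hadm.mul_eq] at this
    exact_mod_cast this
  have hM : (0 : ℝ) < M := by exact_mod_cast hadm.pos_right
  have hS : 0 < X.normSq P.form := normSq_pos hadm h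
  have hlog := Real.log_le_log (by positivity) h
  rw [Real.log_mul (Real.rpow_pos_of_pos hN _).ne' (inv_pos.mpr hM).ne',
    Real.log_rpow hN, Real.log_inv] at hlog
  linarith

/-- **The printed shape with `δ_{D,M}` pinned**: if `P'` realises `δ_{D,M}(E)` on `X`
(`P'.IsMinimalFor W`), the datum `P` of the fact has `P.deg ≤ (9 log N)² · P'.deg` — Cor. 5.3's
`deg φ_{D,M} ≤ (9 log N)² δ_{D,M}` in the `IsMinimalFor` idiom of `PastenShimura2024_thm_6_1(_b)` —
next to `0 < ‖f_{D,M}‖²` and Thm. 14.1's display for `‖f_{D,M}‖²` in both renderings.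
[cite: PastenShimura2024, Cor. 5.3 p. 17 and proof of Thm. 16.1 p. 49] -/
theorem isMinimalFor (h : PastenShimura2024_thm_14_1_fDM) {ε : ℝ} (hε : 0 < ε) :
    ∃ N₀ : ℕ, ∀ {N D M : ℕ}, IsAdmissibleFactorization N D M → 1 < D → N₀ ≤ N →
      ∀ (X : ShimuraCurveData D M) (W : WeierstrassCurve ℚ) [W.IsElliptic] [W.IsGloballyMinimal],
        W.conductorNorm ℤ = N →
        ∀ (W' : WeierstrassCurve ℚ) [W'.IsElliptic] (P' : ShimuraParametrizationData X W'),
          P'.IsMinimalFor W →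
          ∃ (W₀ : WeierstrassCurve ℚ) (_ : W₀.IsElliptic) (_ : W₀.IsGloballyMinimal)
            (P : ShimuraParametrizationData X W₀),
            W.IsIsogenous W₀ ∧ (P.deg : ℝ) ≤ (9 * Real.log N) ^ 2 * P'.deg ∧
              0 < X.normSq P.form ∧
              (N : ℝ) ^ (-(5 / 3 + ε)) * (M : ℝ)⁻¹ ≤ X.normSq P.form ∧
              -Real.log (X.normSq P.form) ≤ (5 / 3 + ε) * Real.log N + Real.log M := by
  obtain ⟨N₀, hN₀⟩ := h ε hε
  refine ⟨N₀, fun hadm hD hN X W _ _ hWN W' _ P' hP' => ?_⟩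
  obtain ⟨W₀, hW₀e, hW₀m, P, hiso, hdeg, hnorm⟩ := hN₀ hadm hD hN X W hWN
  exact ⟨W₀, hW₀e, hW₀m, P, hiso, hdeg W' P' hP'.1, normSq_pos hadm hnorm, hnorm,
    neg_log_normSq_le hadm hnorm⟩

end PastenShimura2024_thm_14_1_fDM

end Literature.NumberTheory.Automorphic

end
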